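import Literature.Geometry.Lorentzian.NearKerrLeaf
import Literature.Geometry.Lorentzian.CutBondiMass
import Literature.Geometry.Lorentzian.FinalState
import HarnessLib

/-!
# Near-Kerr thick-collar cores and their Bondi–Bartnik gap (summit `FinalStateConjecture`)

The predicate `VacuumCauchyDevelopment.NearKerrCollarCore 𝒟 k δ γ N M a S p mo B Φ` wanted by
route `BartnikGapSettling` of the summit `FinalStateConjecture` (work item
`defn-NearKerrCollarCore`, definition request (D2) of the route): the THICK-COLLAR BLOCK shared,
verbatim, by the route's two new cruxes — in `BondiBartnikRigidity`
(stmt-FinalStateConjecture-10807) it is the list of the seven curried hypotheses following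
`p ∈ S`, in `GapExhaustion` (stmt-FinalStateConjecture-10808) it is the tail of the concluding
conjunction — of `Summits/FinalStateConjecture/FinalStateConjecture/Theses/BartnikGapSettling.lean`.
For a vacuum Cauchy development `𝒟` of `3`-dimensional data, a regularity `k`, a closeness
`δ : ℝ≥0∞`, a gap `γ : ℝ`, `N` holes of masses `Mᵢ` and spins `aᵢ`, a set `S ⊆ 𝒟` (in the route:
a near-Kerr leaf, `CauchyDevelopment.IsNearKerrLeaf`), a probe point `p`, motions
`moᵢ = (Λᵢ, cᵢ)`, backgrounds `Bᵢ` and charts `Φᵢ : Bᵢ.domain → 𝒟`, it says: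

* (C1) `Bᵢ` is the boosted Kerr STAR background `starBackground Λᵢ cᵢ Mᵢ aᵢ rᵢ` of
  `NearKerrLeaf.lean` with the boosted Kerr–Schild radius `rᵢ = r_{aᵢ} ∘ (Λᵢ, cᵢ)⁻¹` (domain the
  star region `{rᵢ > Mᵢ}`, horizon-penetrating; Kerr-star time `t*ᵢ`);
* (C2) `Φᵢ` is smooth on the COLLAR LAYER `{−1 < t*ᵢ < 1, rᵢ < 3Mᵢ + 1}` and an open embedding
  of it;
* (C3) the `Cᵏ` deviation of `Φᵢ^* g` from boosted Kerr on the THICK COLLAR SLAB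
  `Bᵢ.truncTimeSlab (3Mᵢ) 0 = {t*ᵢ = 0, Mᵢ < rᵢ ≤ 3Mᵢ}` is `≤ δ`
  (`Spacetime.truncDeviationCk`; the slab contains the slice of the ergoregion, `r_E(θ) ≤ 2M`,
  and the strictly stationary shell `2M < r ≤ 3M`);
* (C4) the collars `Φᵢ({t*ᵢ = 0, rᵢ ≤ 3Mᵢ})` lie in `S`; (C5) they are pairwise disjoint;
* (C6) the CORE `C = {p} ∪ ⋃ᵢ Φᵢ({t*ᵢ = 0, rᵢ ≤ 3Mᵢ})` (`collarCore M p B Φ`) has a cut Bondi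
  energy: `∃ m, 𝒟.HasCutBondiMass C m` (`CutBondiMass.lean`: some asymptotically round receding
  family of sections of `∂J⁺(C)` has Hawking masses tending to `m`);
* (C7) the BONDI–BARTNIK GAP of `C` is `≤ γ`, in infimum-free form: for every COMPETITOR — a
  maximal vacuum Cauchy development `𝒟'` of ADMISSIBLE data (`admissibleVacuumData`), an open
  `U ⊇ C` and `φ : 𝒟 → 𝒟'` smooth on `U`, an open embedding of `U`, isometric
  (`φ^* g' = g` on `U`) and future-directed on `U` — and every cut Bondi energy `m'` of the image
  core `φ(C)` in `𝒟'`, and every `η > 0`, some cut Bondi energy `m` of `C` has `m ≤ m' + γ + η`.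
  This is Bartnik's quasi-local mass — the infimum of the total mass over admissible extensions
  (Bartnik 1989; Huang–Lee arXiv:2007.00593, Def. 7.6 (admissible extension) and Def. 7.8
  (`m_B = inf` over admissible extensions of `m_ADM`)) — transplanted by the route to spacetime
  neighbourhoods of the core, with the Bondi energy of the cut of `𝓘⁺` generated by the core in
  place of the ADM mass ("no-horizon" being automatic: a core hidden behind a competitor's
  horizon generates no receding round sections).

The body is VERBATIM the filed text (up to the names of bound variables and the universe
generalisation `Type ↦ Type u` noted below), so that the two items restate over it with
identical meaning: `GapExhaustion`'s conclusion `… ∧ Disjoint (J⁺ S) (J⁻ K) ∧ ⟨block⟩` becomes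
`… ∧ 𝒟.NearKerrCollarCore k δ γ N M a S p mo' B' Φ` by `Iff.rfl` (the block is the tail of a
right-nested conjunction), and `BondiBartnikRigidity`'s `… → p ∈ S → ⟨seven hypotheses⟩ → ∃ S', …`
becomes `… → p ∈ S → 𝒟.NearKerrCollarCore k' δ γ N M a S p mo' B' Φ → ∃ S', …` by currying
(`nearKerrCollarCore_imp_iff`, a `simp` lemma stated for exactly this purpose). Both agreements
were checked in the session's scratch file against the Theses file, which Literature cannot
import (CONVENTIONS §2).

## Also here

* `collarCore M p B Φ = {p} ∪ ⋃ i, Φ i '' (B i).truncTimeSlab (3 * M i) 0`, the core set written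
  out four times in each of the two items, with its bookkeeping (`mem_collarCore_self`,
  `image_truncTimeSlab_subset_collarCore`, `collarCore_subset`, `collarCore_of_isEmpty`);
* projections of the seven clauses, `NearKerrCollarCore.collarCore_subset` (`C ⊆ S` once
  `p ∈ S`), the star-region domain of the charts, and MONOTONICITY
  (`NearKerrCollarCore.mono`): the block is antitone in `k` and monotone in `δ` and `γ`
  (`supCkENorm_mono_right`; `m ≤ m' + γ + η ≤ m' + γ' + η`).

## Design notes

* *Universes.* The filed items live at `X : Type`; here `X : Type u` and the competitor data
  manifolds `X'` of (C7) range over the SAME universe `Type u` (as in the universe discipline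
  of `VacuumCauchyDevelopment.IsMaximal`: comparison developments in the universe of the data),
  which at `u = 0` is the filed text on the nose.
* *What is deliberately not part of the block* (it stays in the items): `p ∈ S`, the leaf
  predicate `IsNearKerrLeaf k Λ N M a S`, the mass window `m₀ ≤ Mᵢ ≤ 1/m₀`, the margin
  `|aᵢ| ≤ χ Mᵢ`, maximality of `𝒟` and admissibility of its data. In particular the block does
  not ask `0 < Mᵢ` or `|aᵢ| ≤ Mᵢ` (for `Mᵢ ≤ 0` the star domain is `{rᵢ > max Mᵢ 0}` and the
  thick slab `{rᵢ ≤ 3Mᵢ}` is empty, so (C2)–(C5) hold vacuously there — excluded in the items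
  by the mass window).
* *Vacuity/junk.* `δ = ∞` makes (C3) vacuous; `N = 0` is allowed (no collars, `C = {p}`: the
  probe-point case of the route, gap of the cone of a point); the sign of `γ` is unconstrained
  (the route's support item `SelfCompetitor` shows that `𝒟` competes for its own cores when it
  is itself an MGHD of admissible data, whence the gap is `≥ 0` in the intended reading).
  `HasCutBondiMass` is frame-dependent by design (Bondi *energy* in the frame singled out by the
  round family, see `CutBondiMass.lean`, *Frames*); (C6)–(C7) compare energies with energies.
* *Relation to the sibling requests.* (C7) is the clause the sibling request
  `defn-BondiBartnikGapLE` names `BondiBartnikGapLE 𝒟 C γ` (with `C = collarCore M p B Φ`), and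
  (C1)–(C3) for a single chart form the collar-chart hypotheses of `defn-CollarMargin`; no
  bridging lemma is stated here so that the three files stay independent (each is `Iff.rfl`
  against the filed text).

## Sources

Kerr-star coordinates `(t*, r, θ, φ*)`, regular across `𝓗⁺`, the slabs `{t* = τ}` and the
ergoregion: Dafermos–Rodnianski, Clay lectures arXiv:0811.0354, §5.1. `Cᵏ`-closeness to Kerr in
consequence form ("a chart in which `g − g_{a,M}` and `k` derivatives are small"):
Dafermos–Holzegel–Rodnianski–Taylor arXiv:2104.08222, §1, as in `KerrConvergence` /
`NearKerrLeaf`. Bartnik's quasi-local mass: R. Bartnik, Phys. Rev. Lett. 62 (1989) 2346;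
L.-H. Huang, D. A. Lee, arXiv:2007.00593, §7.2, Def. 7.6 and Def. 7.8; R. Bartnik, ICM 2002,
arXiv:math/0304259, Def. 4. Cut Bondi mass as a Hawking-mass limit: Christodoulou–Klainerman
1993, Ch. 17, Conclusion 17.0.4 (`CutBondiMass.lean`). The predicate `NearKerrCollarCore` itself
and the "Bondi–Bartnik gap" have NO printed source: they are posited by the route (planner
`planner-plancard-FinalStateConjecture-FinalSt-091519c0-0`, 2026-08-15) and recorded here so
that its items can be restated readably; nothing is asserted about them.

## Mathlib

No Lorentzian geometry in Mathlib; used are `ContMDiffOn`, `Topology.IsOpenEmbedding`,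
`mfderiv`, `Set` algebra, `Pairwise`, `ℝ≥0∞`.
-/

noncomputable section

open Set TopologicalSpace Filter Topology
open scoped Manifold ContDiff Topology ENNReal

universe u

namespace Literature.Geometry.Lorentzian

/-! ### The core of a probe point and `N` thick collars -/

section CollarCore

variable {α : Type u} {N : ℕ}

/-- The **core** `C = {p} ∪ ⋃ᵢ Φᵢ({t*ᵢ = 0, rᵢ ≤ 3Mᵢ})` of a probe point `p : α` and `N` collar
charts `Φᵢ : (B i).domain → α` with masses `Mᵢ`: the probe point together with the images of the
THICK COLLAR SLABS `(B i).truncTimeSlab (3 * M i) 0 = {t(x) = 0, r(x) ≤ 3Mᵢ}` of the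
backgrounds `Bᵢ` — for the Kerr star background `starBackground` (domain `{rᵢ > Mᵢ}`) the
collar `{t*ᵢ = 0, Mᵢ < rᵢ ≤ 3Mᵢ}`, which for `|a| < M` reaches across the event horizon
`r = r₊ = M + √(M² − a²) ∈ (M, 2M]` and contains the slice of the ergoregion
(`r_E(θ) = M + √(M² − a² cos² θ) ≤ 2M`) and the strictly stationary shell `2M < r ≤ 3M`. This
is the set written `{p} ∪ ⋃ i, Φ i '' (B i).truncTimeSlab (3 * M i) 0` in the filed items of
route `BartnikGapSettling` (a plain abbreviation; the predicate `NearKerrCollarCore` keeps the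
written-out form). Kerr-star slabs `{t* = τ}` and the
ergoregion: Dafermos–Rodnianski arXiv:0811.0354, §5.1. [cite: DafermosRodnianski2008, §5.1] -/
def collarCore (M : Fin N → ℝ) (p : α) (B : Fin N → ModelBackground)
    (Φ : ∀ i, (B i).domain → α) : Set α :=
  {p} ∪ ⋃ i, Φ i '' (B i).truncTimeSlab (3 * M i) 0

variable (M : Fin N → ℝ) (p : α) (B : Fin N → ModelBackground) (Φ : ∀ i, (B i).domain → α)

/-- Unfolding lemma for `collarCore` (DR arXiv:0811.0354, §5.1 for the slabs). [folklore] -/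
theorem collarCore_def :
    collarCore M p B Φ = {p} ∪ ⋃ i, Φ i '' (B i).truncTimeSlab (3 * M i) 0 :=
  rfl

/-- Membership in the core: the probe point, or a point of some thick collar. [folklore] -/
theorem mem_collarCore_iff {q : α} :
    q ∈ collarCore M p B Φ ↔ q = p ∨ ∃ i, q ∈ Φ i '' (B i).truncTimeSlab (3 * M i) 0 := by
  simp only [collarCore, mem_union, mem_singleton_iff, mem_iUnion]

/-- The probe point belongs to the core. [folklore] -/
theorem mem_collarCore_self : p ∈ collarCore M p B Φ :=
  mem_union_left _ (mem_singleton p)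

/-- Each thick collar lies in the core. [folklore] -/
theorem image_truncTimeSlab_subset_collarCore (i : Fin N) :
    Φ i '' (B i).truncTimeSlab (3 * M i) 0 ⊆ collarCore M p B Φ :=
  (subset_iUnion (fun i ↦ Φ i '' (B i).truncTimeSlab (3 * M i) 0) i).trans subset_union_right

/-- The core lies in every set containing the probe point and the thick collars (in the route:
the leaf `S`, by `p ∈ S` and clause (C4)). [folklore] -/
theorem collarCore_subset {S : Set α} (hp : p ∈ S)
    (h : ∀ i, Φ i '' (B i).truncTimeSlab (3 * M i) 0 ⊆ S) : collarCore M p B Φ ⊆ S :=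
  union_subset (singleton_subset_iff.2 hp) (iUnion_subset h)

/-- Without collars (`N = 0`) the core is the probe point alone (the route's probe-point case).
[folklore] -/
theorem collarCore_of_isEmpty [IsEmpty (Fin N)] : collarCore M p B Φ = {p} := by
  rw [collarCore, iUnion_of_empty, union_empty]

end CollarCore

/-! ### The thick-collar block -/

namespace VacuumCauchyDevelopment

variable {X : Type u} [TopologicalSpace X] [ChartedSpace E3 X] [IsManifold (𝓡 3) ∞ X]
  [ConnectedSpace X] {D : InitialDataSet (𝓡 3) X}

/-- **Near-Kerr thick-collar core with Bondi–Bartnik gap `≤ γ`** (route-posited notion of route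
`BartnikGapSettling`, summit `FinalStateConjecture`; verbatim the block shared by its items
`BondiBartnikRigidity` (curried hypotheses) and `GapExhaustion` (tail of the conclusion), see the
module docstring). For the vacuum Cauchy development `𝒟`, regularity `k`, closeness `δ`, gap
`γ`, `N` holes of masses `M` and spins `a`, a set `S ⊆ 𝒟`, a probe point `p`, motions
`moᵢ = (Λᵢ, cᵢ)`, backgrounds `Bᵢ` and charts `Φᵢ : Bᵢ.domain → 𝒟`: (C1) each `Bᵢ` is the
boosted Kerr star background `starBackground Λᵢ cᵢ Mᵢ aᵢ (r_{aᵢ} ∘ (Λᵢ,cᵢ)⁻¹)` (domain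
`{rᵢ > Mᵢ}`, Kerr-star time); (C2) `Φᵢ` is smooth on the collar layer
`{−1 < t*ᵢ < 1, rᵢ < 3Mᵢ + 1}` and an open embedding of it; (C3) the `Cᵏ` deviation of
`Φᵢ^* g` from boosted Kerr on the thick collar slab `{t*ᵢ = 0, rᵢ ≤ 3Mᵢ}` is `≤ δ`; (C4) the
collars `Φᵢ({t*ᵢ = 0, rᵢ ≤ 3Mᵢ})` lie in `S` and (C5) are pairwise disjoint; (C6) the core
`C = {p} ∪ ⋃ᵢ Φᵢ({t*ᵢ = 0, rᵢ ≤ 3Mᵢ})` has a cut Bondi energy, `∃ m, HasCutBondiMass C m`;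
(C7) for every competitor — an MGHD `𝒟'` of admissible vacuum data `D'` on some `X'`, an open
`U ⊇ C`, `φ : 𝒟 → 𝒟'` smooth on `U`, an open embedding of `U`, isometric (`φ^* g' = g` on `U`)
and future-directed on `U` — every cut Bondi energy `m'` of `φ(C)` in `𝒟'` and every `η > 0`,
some cut Bondi energy `m` of `C` satisfies `m ≤ m' + γ + η` ("Bondi–Bartnik gap `≤ γ`":
Bartnik's infimum over admissible extensions, Huang–Lee arXiv:2007.00593, Def. 7.6 and 7.8,
with the Bondi energy of the core's cut in place of the ADM mass). Write
`𝒟.NearKerrCollarCore k δ γ N M a S p mo B Φ`. Nothing is asserted about the notion here.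
[cite: HuangLee2020, Def. 7.8] -/
def NearKerrCollarCore (𝒟 : VacuumCauchyDevelopment D) (k : ℕ) (δ : ℝ≥0∞) (γ : ℝ) (N : ℕ)
    (M a : Fin N → ℝ) (S : Set 𝒟.carrier) (p : 𝒟.carrier) (mo : Fin N → lorentzGroup × E4)
    (B : Fin N → ModelBackground) (Φ : ∀ i, (B i).domain → 𝒟.carrier) : Prop :=
  (∀ i, B i = starBackground (mo i).1 (mo i).2 (M i) (a i)
    (fun x => Kerr.radius (a i) (poincareInv (mo i).1 (mo i).2 x))) ∧
  (∀ i, ContMDiffOn 𝓘(ℝ, E4) (𝓡 4) ∞ (Φ i)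
      {x | -1 < (B i).time x.1 ∧ (B i).time x.1 < 1 ∧ (B i).radius x.1 < 3 * M i + 1} ∧
    IsOpenEmbedding
      ({x | -1 < (B i).time x.1 ∧ (B i).time x.1 < 1 ∧ (B i).radius x.1 < 3 * M i + 1}.restrict
        (Φ i))) ∧
  (∀ i, 𝒟.toSpacetime.truncDeviationCk (B i) (Φ i) k (3 * M i) 0 ≤ δ) ∧
  (∀ i, Φ i '' (B i).truncTimeSlab (3 * M i) 0 ⊆ S) ∧
  Pairwise (Function.onFun Disjoint fun i => Φ i '' (B i).truncTimeSlab (3 * M i) 0) ∧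
  (∃ m : ℝ, 𝒟.toCauchyDevelopment.HasCutBondiMass
    ({p} ∪ ⋃ i, Φ i '' (B i).truncTimeSlab (3 * M i) 0) m) ∧
  (∀ (X' : Type u) [TopologicalSpace X'] [ChartedSpace E3 X'] [IsManifold (𝓡 3) ∞ X']
    [T2Space X'] [SecondCountableTopology X'] [ConnectedSpace X'],
    ∀ D' ∈ admissibleVacuumData X', ∀ (𝒟' : VacuumCauchyDevelopment D') (U : Set 𝒟.carrier)
      (φ : 𝒟.carrier → 𝒟'.carrier) (m' : ℝ), 𝒟'.IsMaximal → IsOpen U →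
      ({p} ∪ ⋃ i, Φ i '' (B i).truncTimeSlab (3 * M i) 0) ⊆ U →
      ContMDiffOn (𝓡 4) (𝓡 4) ∞ φ U → IsOpenEmbedding (U.restrict φ) →
      (∀ q ∈ U, pullbackBilin (I := 𝓡 4) (I' := 𝓡 4) φ 𝒟'.metric.val q = 𝒟.metric.val q) →
      (∀ q ∈ U, 𝒟'.timeOrientation.IsFutureDirected
        (mfderiv (𝓡 4) (𝓡 4) φ q (𝒟.timeOrientation.vectorField q))) →
      𝒟'.toCauchyDevelopment.HasCutBondiMass
        (φ '' ({p} ∪ ⋃ i, Φ i '' (B i).truncTimeSlab (3 * M i) 0)) m' →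
      ∀ η : ℝ, 0 < η → ∃ m : ℝ, 𝒟.toCauchyDevelopment.HasCutBondiMass
        ({p} ∪ ⋃ i, Φ i '' (B i).truncTimeSlab (3 * M i) 0) m ∧ m ≤ m' + γ + η)

variable {𝒟 : VacuumCauchyDevelopment D} {k k' : ℕ} {δ δ' : ℝ≥0∞} {γ γ' : ℝ} {N : ℕ}
  {M a : Fin N → ℝ} {S : Set 𝒟.carrier} {p : 𝒟.carrier} {mo : Fin N → lorentzGroup × E4}
  {B : Fin N → ModelBackground} {Φ : ∀ i, (B i).domain → 𝒟.carrier}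

/-- **Currying.** An implication out of the thick-collar block is the chain of seven implications
out of its clauses — the form in which the block appears among the hypotheses of the route item
`BondiBartnikRigidity`; as a `simp` lemma it turns `… → 𝒟.NearKerrCollarCore … → R` into the
filed curried text. [folklore] -/
@[simp]
theorem nearKerrCollarCore_imp_iff {R : Prop} :
    (𝒟.NearKerrCollarCore k δ γ N M a S p mo B Φ → R) ↔
      ((∀ i, B i = starBackground (mo i).1 (mo i).2 (M i) (a i)
          (fun x => Kerr.radius (a i) (poincareInv (mo i).1 (mo i).2 x))) →
        (∀ i, ContMDiffOn 𝓘(ℝ, E4) (𝓡 4) ∞ (Φ i)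
            {x | -1 < (B i).time x.1 ∧ (B i).time x.1 < 1 ∧ (B i).radius x.1 < 3 * M i + 1} ∧
          IsOpenEmbedding
            ({x | -1 < (B i).time x.1 ∧ (B i).time x.1 < 1 ∧
                (B i).radius x.1 < 3 * M i + 1}.restrict (Φ i))) →
        (∀ i, 𝒟.toSpacetime.truncDeviationCk (B i) (Φ i) k (3 * M i) 0 ≤ δ) →
        (∀ i, Φ i '' (B i).truncTimeSlab (3 * M i) 0 ⊆ S) →
        Pairwise (Function.onFun Disjoint fun i => Φ i '' (B i).truncTimeSlab (3 * M i) 0) →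
        (∃ m : ℝ, 𝒟.toCauchyDevelopment.HasCutBondiMass
          ({p} ∪ ⋃ i, Φ i '' (B i).truncTimeSlab (3 * M i) 0) m) →
        (∀ (X' : Type u) [TopologicalSpace X'] [ChartedSpace E3 X'] [IsManifold (𝓡 3) ∞ X']
          [T2Space X'] [SecondCountableTopology X'] [ConnectedSpace X'],
          ∀ D' ∈ admissibleVacuumData X', ∀ (𝒟' : VacuumCauchyDevelopment D')
            (U : Set 𝒟.carrier) (φ : 𝒟.carrier → 𝒟'.carrier) (m' : ℝ), 𝒟'.IsMaximal →
            IsOpen U → ({p} ∪ ⋃ i, Φ i '' (B i).truncTimeSlab (3 * M i) 0) ⊆ U →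
            ContMDiffOn (𝓡 4) (𝓡 4) ∞ φ U → IsOpenEmbedding (U.restrict φ) →
            (∀ q ∈ U,
              pullbackBilin (I := 𝓡 4) (I' := 𝓡 4) φ 𝒟'.metric.val q = 𝒟.metric.val q) →
            (∀ q ∈ U, 𝒟'.timeOrientation.IsFutureDirected
              (mfderiv (𝓡 4) (𝓡 4) φ q (𝒟.timeOrientation.vectorField q))) →
            𝒟'.toCauchyDevelopment.HasCutBondiMass
              (φ '' ({p} ∪ ⋃ i, Φ i '' (B i).truncTimeSlab (3 * M i) 0)) m' →
            ∀ η : ℝ, 0 < η → ∃ m : ℝ, 𝒟.toCauchyDevelopment.HasCutBondiMass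
              ({p} ∪ ⋃ i, Φ i '' (B i).truncTimeSlab (3 * M i) 0) m ∧ m ≤ m' + γ + η) →
        R) :=
  ⟨fun h h₁ h₂ h₃ h₄ h₅ h₆ h₇ ↦ h ⟨h₁, h₂, h₃, h₄, h₅, h₆, h₇⟩,
    fun h hc ↦ h hc.1 hc.2.1 hc.2.2.1 hc.2.2.2.1 hc.2.2.2.2.1 hc.2.2.2.2.2.1 hc.2.2.2.2.2.2⟩

namespace NearKerrCollarCore

/-- (C1) The backgrounds of the block are the boosted Kerr star backgrounds with the boosted
Kerr–Schild radius (DR arXiv:0811.0354, §5.1). [cite: DafermosRodnianski2008, §5.1] -/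
theorem background_eq (h : 𝒟.NearKerrCollarCore k δ γ N M a S p mo B Φ) (i : Fin N) :
    B i = starBackground (mo i).1 (mo i).2 (M i) (a i)
      (fun x => Kerr.radius (a i) (poincareInv (mo i).1 (mo i).2 x)) :=
  h.1 i

/-- (C1, unfolded) The chart domains are the boosted star regions
`{x | Λᵢ⁻¹(x − cᵢ) ∈ Kerr.region aᵢ Mᵢ} = {rᵢ > max Mᵢ 0}` — horizon-penetrating, since
`M ≤ r₊` (DR arXiv:0811.0354, §5.1). [cite: DafermosRodnianski2008, §5.1] -/
theorem coe_domain_eq (h : 𝒟.NearKerrCollarCore k δ γ N M a S p mo B Φ) (i : Fin N) :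
    ((B i).domain : Set E4) = poincareInv (mo i).1 (mo i).2 ⁻¹' (Kerr.region (a i) (M i)) := by
  rw [h.background_eq i, coe_starBackground_domain]

/-- (C1, unfolded) The time and radius functions of the charts are the rest-frame Kerr-star time
`(Λᵢ⁻¹(x − cᵢ))⁰` and the boosted Kerr–Schild radius (DR arXiv:0811.0354, §5.1).
[cite: DafermosRodnianski2008, §5.1] -/
theorem time_eq_and_radius_eq (h : 𝒟.NearKerrCollarCore k δ γ N M a S p mo B Φ) (i : Fin N) :
    (B i).time = (fun x => poincareInv (mo i).1 (mo i).2 x 0) ∧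
      (B i).radius = fun x => Kerr.radius (a i) (poincareInv (mo i).1 (mo i).2 x) := by
  rw [h.background_eq i]
  exact ⟨rfl, rfl⟩

/-- (C2) Each collar chart is smooth on its collar layer `{−1 < t*ᵢ < 1, rᵢ < 3Mᵢ + 1}`
(DHRT arXiv:2104.08222, §1, chart vocabulary). [cite: DafermosHolzegelRodnianskiTaylor2021, §1] -/
theorem contMDiffOn (h : 𝒟.NearKerrCollarCore k δ γ N M a S p mo B Φ) (i : Fin N) :
    ContMDiffOn 𝓘(ℝ, E4) (𝓡 4) ∞ (Φ i)
      {x | -1 < (B i).time x.1 ∧ (B i).time x.1 < 1 ∧ (B i).radius x.1 < 3 * M i + 1} :=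
  (h.2.1 i).1

/-- (C2) Each collar chart is an open embedding of its collar layer (DHRT arXiv:2104.08222, §1).
[cite: DafermosHolzegelRodnianskiTaylor2021, §1] -/
theorem isOpenEmbedding (h : 𝒟.NearKerrCollarCore k δ γ N M a S p mo B Φ) (i : Fin N) :
    IsOpenEmbedding
      ({x | -1 < (B i).time x.1 ∧ (B i).time x.1 < 1 ∧ (B i).radius x.1 < 3 * M i + 1}.restrict
        (Φ i)) :=
  (h.2.1 i).2

/-- (C3) On the thick collar slab `{t*ᵢ = 0, rᵢ ≤ 3Mᵢ}` the `Cᵏ` deviation from boosted Kerr is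
`≤ δ` (DHRT arXiv:2104.08222, §1, closeness in consequence form).
[cite: DafermosHolzegelRodnianskiTaylor2021, §1] -/
theorem truncDeviationCk_le (h : 𝒟.NearKerrCollarCore k δ γ N M a S p mo B Φ) (i : Fin N) :
    𝒟.toSpacetime.truncDeviationCk (B i) (Φ i) k (3 * M i) 0 ≤ δ :=
  h.2.2.1 i

/-- (C4) The thick collars lie in `S`. [folklore] -/
theorem image_subset (h : 𝒟.NearKerrCollarCore k δ γ N M a S p mo B Φ) (i : Fin N) :
    Φ i '' (B i).truncTimeSlab (3 * M i) 0 ⊆ S :=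
  h.2.2.2.1 i

/-- (C5) The thick collars are pairwise disjoint. [folklore] -/
theorem pairwise_disjoint (h : 𝒟.NearKerrCollarCore k δ γ N M a S p mo B Φ) :
    Pairwise (Function.onFun Disjoint fun i => Φ i '' (B i).truncTimeSlab (3 * M i) 0) :=
  h.2.2.2.2.1

/-- (C6) The core has a cut Bondi energy (Christodoulou–Klainerman 1993, Ch. 17, Conclusion
17.0.4, for the notion `HasCutBondiMass`).
[cite: ChristodoulouKlainerman1993PMS41, Ch. 17, Conclusion 17.0.4] -/
theorem hasCutBondiMass (h : 𝒟.NearKerrCollarCore k δ γ N M a S p mo B Φ) :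
    ∃ m : ℝ, 𝒟.toCauchyDevelopment.HasCutBondiMass (collarCore M p B Φ) m :=
  h.2.2.2.2.2.1

/-- (C7) The Bondi–Bartnik gap of the core is `≤ γ`: against every competitor mass `m'` and every
`η > 0` the core has a cut Bondi energy `≤ m' + γ + η` (Bartnik's infimum, Huang–Lee
arXiv:2007.00593, Def. 7.8, in the route's Bondi form). [cite: HuangLee2020, Def. 7.8] -/
theorem gap (h : 𝒟.NearKerrCollarCore k δ γ N M a S p mo B Φ) (X' : Type u)
    [TopologicalSpace X'] [ChartedSpace E3 X'] [IsManifold (𝓡 3) ∞ X'] [T2Space X']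
    [SecondCountableTopology X'] [ConnectedSpace X'] {D' : InitialDataSet (𝓡 3) X'}
    (hD' : D' ∈ admissibleVacuumData X') (𝒟' : VacuumCauchyDevelopment D') {U : Set 𝒟.carrier}
    {φ : 𝒟.carrier → 𝒟'.carrier} {m' : ℝ} (hmax : 𝒟'.IsMaximal) (hU : IsOpen U)
    (hCU : collarCore M p B Φ ⊆ U) (hφ : ContMDiffOn (𝓡 4) (𝓡 4) ∞ φ U)
    (hemb : IsOpenEmbedding (U.restrict φ))
    (hiso : ∀ q ∈ U, pullbackBilin (I := 𝓡 4) (I' := 𝓡 4) φ 𝒟'.metric.val q = 𝒟.metric.val q)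
    (hfut : ∀ q ∈ U, 𝒟'.timeOrientation.IsFutureDirected
      (mfderiv (𝓡 4) (𝓡 4) φ q (𝒟.timeOrientation.vectorField q)))
    (hm' : 𝒟'.toCauchyDevelopment.HasCutBondiMass (φ '' collarCore M p B Φ) m') {η : ℝ}
    (hη : 0 < η) :
    ∃ m : ℝ, 𝒟.toCauchyDevelopment.HasCutBondiMass (collarCore M p B Φ) m ∧ m ≤ m' + γ + η :=
  h.2.2.2.2.2.2 X' D' hD' 𝒟' U φ m' hmax hU hCU hφ hemb hiso hfut hm' η hη

/-- The core lies in `S` as soon as the probe point does (clause (C4)). [folklore] -/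
theorem collarCore_subset (h : 𝒟.NearKerrCollarCore k δ γ N M a S p mo B Φ) (hp : p ∈ S) :
    collarCore M p B Φ ⊆ S :=
  Lorentzian.collarCore_subset M p B Φ hp h.image_subset

/-- **Monotonicity.** The thick-collar block is antitone in the regularity `k` and monotone in
the closeness `δ` and in the gap `γ`, with the same charts: `Cᵏ` sup norms grow with `k`
(`supCkENorm_mono_right`; DHRT arXiv:2104.08222, §1, closeness with loss of derivatives) and
`m ≤ m' + γ + η ≤ m' + γ' + η`. [cite: DafermosHolzegelRodnianskiTaylor2021, §1] -/
theorem mono (h : 𝒟.NearKerrCollarCore k' δ γ N M a S p mo B Φ) (hk : k ≤ k') (hδ : δ ≤ δ')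
    (hγ : γ ≤ γ') : 𝒟.NearKerrCollarCore k δ' γ' N M a S p mo B Φ := by
  obtain ⟨hB, hΦ, hdev, hS, hdisj, hmass, hgap⟩ := h
  refine ⟨hB, hΦ, fun i ↦ ((supCkENorm_mono_right _ hk _).trans (hdev i)).trans hδ, hS, hdisj,
    hmass, ?_⟩
  intro X' _ _ _ _ _ _ D' hD' 𝒟' U φ m' hmax hU hCU hφ hemb hiso hfut hm' η hη
  obtain ⟨m, hm, hle⟩ := hgap X' D' hD' 𝒟' U φ m' hmax hU hCU hφ hemb hiso hfut hm' η hη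
  exact ⟨m, hm, hle.trans (by linarith)⟩

/-- Without collars (`N = 0`) the block reduces to its last two clauses for the core `{p}`: the
cone of the probe point has a cut Bondi energy and Bondi–Bartnik gap `≤ γ` (the route's
probe-point case). [folklore] -/
theorem of_isEmpty [IsEmpty (Fin N)]
    (hmass : ∃ m : ℝ, 𝒟.toCauchyDevelopment.HasCutBondiMass (collarCore M p B Φ) m)
    (hgap : ∀ (X' : Type u) [TopologicalSpace X'] [ChartedSpace E3 X'] [IsManifold (𝓡 3) ∞ X']
      [T2Space X'] [SecondCountableTopology X'] [ConnectedSpace X'],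
      ∀ D' ∈ admissibleVacuumData X', ∀ (𝒟' : VacuumCauchyDevelopment D') (U : Set 𝒟.carrier)
        (φ : 𝒟.carrier → 𝒟'.carrier) (m' : ℝ), 𝒟'.IsMaximal → IsOpen U →
        collarCore M p B Φ ⊆ U → ContMDiffOn (𝓡 4) (𝓡 4) ∞ φ U →
        IsOpenEmbedding (U.restrict φ) →
        (∀ q ∈ U, pullbackBilin (I := 𝓡 4) (I' := 𝓡 4) φ 𝒟'.metric.val q = 𝒟.metric.val q) →
        (∀ q ∈ U, 𝒟'.timeOrientation.IsFutureDirected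
          (mfderiv (𝓡 4) (𝓡 4) φ q (𝒟.timeOrientation.vectorField q))) →
        𝒟'.toCauchyDevelopment.HasCutBondiMass (φ '' collarCore M p B Φ) m' →
        ∀ η : ℝ, 0 < η → ∃ m : ℝ,
          𝒟.toCauchyDevelopment.HasCutBondiMass (collarCore M p B Φ) m ∧ m ≤ m' + γ + η) :
    𝒟.NearKerrCollarCore k δ γ N M a S p mo B Φ :=
  ⟨fun i ↦ isEmptyElim i, fun i ↦ isEmptyElim i, fun i ↦ isEmptyElim i, fun i ↦ isEmptyElim i,
    fun i _ _ ↦ isEmptyElim i, hmass, hgap⟩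

end NearKerrCollarCore

end VacuumCauchyDevelopment

end Literature.Geometry.Lorentzian

end
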